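import Literature.NumberTheory.PAdicHodge.BdRPlusRamifiedLogEvalTower
import Literature.NumberTheory.PAdicHodge.BdRPlusRamifiedLogEvalReindex
import Literature.NumberTheory.PAdicHodge.BdRPlusRamifiedLogEvalLinear
import Literature.NumberTheory.PAdicHodge.BmaxPlusLogSumLevelDescent
import Literature.NumberTheory.PAdicHodge.BmaxPlusTransportedPeriodHom
import HarnessLib

/-!
# The transported Hodge combination IS `p^{N+c}·∫ω_{W_D}` in `B_dR⁺`: `Σᵢ ϖⁱ(aᵢ·P⁰τ + bᵢ·Q⁰τ) = p^{N+c}·∫_τ ω` — hence `hne` for the K★ cells WITHOUT Fontaine injectivity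

Cell `pub/bsd-wall`, D-0145 line `route-BirchSwinnertonDyer-EdixhovenFibreFiveSeven`, seat `bsd-line-edix-p1` (gen 28); crux K★ `stmt-BirchSwinnertonDyer-22226`
(`StarredOptimalManinUnitFiveSeven`), line `kato_lever`, memo `Cruxes/StarredOptimalManinUnitFiveSeven/Lines/kato-lever-K2-hne-direct-omega.md` (F3c). THEOREMS ONLY
(no definition, no named fact, no instance, no `sorry`); helper `--supports stmt-BirchSwinnertonDyer-22226`. **BSD is not proved by this file, and neither is K★.**

THE STATEMENT (`transported_hodgeCombination_eq_pow_mul_omegaPeriod`). Setting of edix-p4's transported period maps (`BmaxPlusTransportedPeriodHom`,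
`…HomsBdR`): `W = W_D/𝒪_D ≡ E₀ (mod ϖ)`, `τ ∈ T_pŴ_D`, `LT τ = Λ_N(ι[T(τ)~], z)`, `P⁰ = f∘LT`, `Q⁰ = f∘φ∘LT`. Let the Hodge line be given in NUMERATOR form
(hypothesis `hHL`, with `a b : Fin e → ℤ_p`, integral remainders `h : Fin e → ℕ → ℤ_p`, exponent `c`):
`p^c·[X^{m−1}]ω_W = Σᵢ ϖⁱ·(aᵢ·b^{E₀}_m + bᵢ·(b^{E₀})⁽ᵖ⁾_m + m·hᵢ,ₘ)` in `𝒪_D` (i.e. `p^c·log_W = Σᵢ ϖⁱ(aᵢ log_{E₀} + bᵢ log_{E₀}(Xᵖ) + hᵢ)`, `hᵢ ∈ ℤ_p⟦X⟧`). Then for EVERY `τ`: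
**`Σᵢ ι_F(ϖ)ⁱ·(aᵢ·P⁰τ + bᵢ·Q⁰τ) = p^{N+c} · ∫_τ ω_{W_D}`** where `∫_τ ω_{W_D} = AinfRamTop.omegaPeriod W …` is the DIRECT ξ-adic ω-period of the ramified model (K1, tree).
Consequently (`transported_hodgeCombination_ne_zero`) the combination is `≠ 0` whenever `∫_τ ω ≠ 0` — which the tree's (N1′) (`omegaPeriod_model_five/seven_ne_zero`) gives
for `τ₁ ≠ 0` on the three potentially supersingular K★ cells. This is the capstone's `hne` for `Pω″ = A·P⁰ + B·Q⁰` in BOTH branches, with NO appeal to Fontaine's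
injectivity `F ⊗_{F₀} B_max⁺ → B_dR⁺` (edix-p4's named fact is needed only for the stronger `∀ (a, b)` independence).

THE PROOF (memo §1). Modulo each `Fil^k`, for each `j`: descend both sides to a deep level `n` of the towers — E₀-side `P⁰τ = p^{N+n}·L₁`, `Q⁰τ = p^{N+n}·L₂` with `L₁, L₂` `p`-adic
values of `log_{E₀}` at `[w̃⁽ⁿ⁾]`, `φ[w̃⁽ⁿ⁾]` (`BmaxPlusLogSumLevelDescent`), W-side `∫_τ ω = pⁿ·V₃` with `V₃` a value of `log_W` at `[τ̃⁽ⁿ⁾]_𝒪` (`BdRPlusRamifiedLogEvalTower`);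
evaluate `hHL` at the shallow point `[τ̃⁽ⁿ⁾]_𝒪` (linearity of values, `BdRPlusRamifiedLogEvalLinear`; the `Xᵖ`-series = the series at the `p`-th power,
`BdRPlusRamifiedLogEvalReindex`; the integral `hᵢ` are bounded); the three shallow points have θ-values `τₙ, wₙ, ≡ wₙᵖ` with `‖wₙ − τₙ‖ ≤ ‖ϖ‖`, so they are
`(ϖ, ω_𝒪)`-close and the UNIFORM continuity (`BdRPlusRamifiedLogEvalContinuity`) bounds the discrepancies by `p^{−C}` independently of `n`; the prefactor `p^{N+n}`
then puts the difference of the two sides in `Λ(j, k)`. All `j`, all `k` ⟹ equality (`eq_zero_of_forall_lattice`).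

References: [cite: Fontaine1982FormesDifferentielles, §5] · [cite: Colmez1992PeriodesAbeliennes, §2] · [cite: FontaineAsterisque223III, Exp. II §1.5] ·
[cite: Katz1981CrystallineDieudonne, Thm. 5.1.4].
-/

set_option autoImplicit false
-- single-conjunct summit: `Summit.BirchSwinnertonDyer.BirchSwinnertonDyer.…` repeats the name by design
set_option linter.dupNamespace false

noncomputable section

open scoped Classical
open ValuativeRel Field Ideal WittVector Finset Literature.NumberTheory.PAdicHodge
  Literature.NumberTheory.GaloisRepresentations Literature.NumberTheory.GaloisRepresentations.IsNonarchimedeanLocalField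
  Literature.NumberTheory.GaloisRepresentations.LubinTate Literature.RingTheory.FormalGroups Literature.NumberTheory.PAdicHodge.GaloisContinuity

namespace Summit.BirchSwinnertonDyer.BirchSwinnertonDyer.Theorems.TransportedHodgeLineBdR

variable {F : Type} [Field F] [ValuativeRel F] [TopologicalSpace F] [IsNonarchimedeanLocalField F] [CharZero F]
  {p : ℕ} [hpp : Fact p.Prime] [Fact (¬ IsUnit (p : integerC F))] [IsAdicComplete (Ideal.span {(p : integerC F)}) (integerC F)]
  {hp : valuation F p < 1} (D : EisensteinRoot F p hp) {hθ : Function.Surjective (fontaineTheta (integerC F) p)}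
  (W : WeierstrassCurve (EisensteinRoot.CoeffDisc D)) (E₀ : WeierstrassCurve ℤ)
  (hWE : W.map (Ideal.Quotient.mk (Ideal.span {EisensteinRoot.CoeffDisc.of D (AdjoinRoot.root D.poly)})) =
    (E₀.map (algebraMap ℤ (EisensteinRoot.CoeffDisc D))).map
      (Ideal.Quotient.mk (Ideal.span {EisensteinRoot.CoeffDisc.of D (AdjoinRoot.root D.poly)})))
  (ψ : EisensteinRoot.CoeffDisc D →+* LTCoeff F) (hψ : ∀ c, algebraMap (LTCoeff F) F (ψ c) = EisensteinRoot.CoeffDisc.toF D c)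

/-- `ι_𝒪(ϖⁱ) = ι_F(ϖ)ⁱ` and `ι_𝒪(a) = ι(a)` for `a ∈ ℤ_p`: the scalars of the Hodge combination as images of `𝒪_D`-elements. [cite: FontaineAsterisque223III, Exp. II §1.5.3] -/
theorem toBdR_coeffHom_root_pow (i : ℕ) :
    AinfRam.toBdR D hθ (AinfRam.coeffHom D (AdjoinRoot.root D.poly ^ i)) = embBdRHom hp hθ (D.root ^ i) := by
  rw [map_pow, map_pow, AinfRam.coeffHom_root, AinfRam.toBdR_varpi, map_pow]

/-- `ι_𝒪(a) = ι(a)` for `a ∈ ℤ_p ⊂ 𝒪_D`. [cite: FontaineAsterisque223III, Exp. II §1.5.3] -/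
theorem toBdR_coeffHom_of (z : ℤ_[p]) :
    AinfRam.toBdR D hθ (AinfRam.coeffHom D (AdjoinRoot.of D.poly z)) = qpToBdR (z : ℚ_[p]) := by
  rw [AinfRam.coeffHom_of, AinfRam.toBdR_algebraMap, qpToBdR_coe]

include hWE hψ in
set_option maxHeartbeats 6400000 in
/-- ★★★ **The transported Hodge combination is `p^{N+c}·∫ω_{W_D}`.** With the Hodge line in numerator form (`hHL`), edix-p4's transported period maps
`P⁰ = f∘LT`, `Q⁰ = f∘φ∘LT` (`hLT`, `hP₀`, `hQ₀`, index `N ≥ e`) and the direct ξ-adic ω-period `∫_τ ω = AinfRamTop.omegaPeriod W …` of the ramified model: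
`Σᵢ ι_F(ϖ)ⁱ·(aᵢ·P⁰τ + bᵢ·Q⁰τ) = p^{N+c}·∫_τ ω` for every `τ ∈ T_pŴ_D`. [cite: Fontaine1982FormesDifferentielles, §5] [cite: Colmez1992PeriodesAbeliennes, §2]
[cite: Katz1981CrystallineDieudonne, Thm. 5.1.4] -/
theorem transported_hodgeCombination_eq_pow_mul_omegaPeriod
    [(E₀.map (Int.castRingHom ℚ_[p])).IsElliptic] [(E₀.map (Int.castRingHom (ZMod p))).IsElliptic]
    {N : ℕ} (hN : D.e ≤ N) {LT : AinfTop.TatePtO F (W.map ψ) p →+ BmaxPlus F p} {P₀ Q₀ : AinfTop.TatePtO F (W.map ψ) p →+ BdRPlusTop F p}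
    (hLT : ∀ (τ : AinfTop.TatePtO F (W.map ψ) p) (w : ℕ → (maxNilIdealC F).toIdeal) (hw : ∀ n, AinfTop.mulPC F p E₀ (w (n + 1)) = w n)
        (_ : ∀ n, ‖(((w n : (maxNilIdealC F).toIdeal) : CBall F) : CompletedAlgClosure F) -
      (((AinfTop.seqO (W.map ψ) τ n : (maxNilIdealC F).toIdeal) : CBall F) : CompletedAlgClosure F)‖ ≤ ‖((D.rootC : integerC F) : CompletedAlgClosure F)‖)
        (z : bmaxZero F p), algebraMap (Ainf (p := p) F) (bmaxZero F p)
        ((AinfTop.of F p).symm (((AinfTop.divisionLiftPt E₀ hθ w hw).val : (AinfTop.nilTheta F p hθ).toIdeal) : AinfTop F p)) ^ N =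
      (p : bmaxZero F p) * z →
        LT τ = PadicLogSeries.logSum ((algebraMap (Ainf (p := p) F) (bmaxZero F p)).comp zpToAinf) (GaloisContinuity.formalLogNum E₀ p) N
          (algebraMap (Ainf (p := p) F) (bmaxZero F p)
            ((AinfTop.of F p).symm (((AinfTop.divisionLiftPt E₀ hθ w hw).val : (AinfTop.nilTheta F p hθ).toIdeal) : AinfTop F p))) z)
    (hP₀ : ∀ τ, P₀ τ = BdRPlusTop.of F p (bmaxPlusToBdR F p (LT τ)))
    (hQ₀ : ∀ τ, Q₀ τ = BdRPlusTop.of F p (bmaxPlusToBdR F p (frobBmaxPlus F p (LT τ))))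
    (c : ℕ) (a bb : Fin D.e → ℤ_[p]) (h : Fin D.e → ℕ → ℤ_[p])
    (hHL : ∀ m : ℕ, (p : D.Coeff) ^ c * (EisensteinRoot.CoeffDisc.of D).symm (PowerSeries.coeff (m - 1) W.formalInvDiff) =
      ∑ i : Fin D.e, AdjoinRoot.root D.poly ^ (i : ℕ) *
        (AdjoinRoot.of D.poly (a i) * AdjoinRoot.of D.poly (GaloisContinuity.formalLogNum E₀ p m) +
          AdjoinRoot.of D.poly (bb i) * (if p ∣ m then (p : D.Coeff) * AdjoinRoot.of D.poly (GaloisContinuity.formalLogNum E₀ p (m / p)) else 0) +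
          (m : D.Coeff) * AdjoinRoot.of D.poly (h i m)))
    (τ : AinfTop.TatePtO F (W.map ψ) p) :
    ∑ i : Fin D.e, BdRPlusTop.of F p (embBdRHom hp hθ (D.root ^ (i : ℕ))) *
        (BdRPlusTop.of F p (qpToBdR (a i : ℚ_[p])) * P₀ τ + BdRPlusTop.of F p (qpToBdR (bb i : ℚ_[p])) * Q₀ τ) =
      (p : BdRPlusTop F p) ^ (N + c) *
        AinfRamTop.omegaPeriod W hθ (AinfTop.seqO (W.map ψ) τ) (AinfTop.seqO_zero (W.map ψ) τ) (AinfRamTop.mulPC_seqO W ψ hψ τ) := by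
  -- abbreviations
  set t : ℕ → (maxNilIdealC F).toIdeal := AinfTop.seqO (W.map ψ) τ with ht
  have ht0 : (t 0 : CBall F) = 0 := AinfTop.seqO_zero (W.map ψ) τ
  have htp : ∀ n, AinfRamTop.mulPC W (t (n + 1)) = t n := AinfRamTop.mulPC_seqO W ψ hψ τ
  set βW : ℕ → D.Coeff := fun m => (EisensteinRoot.CoeffDisc.of D).symm (PowerSeries.coeff (m - 1) W.formalInvDiff) with hβW
  set bE : ℕ → D.Coeff := fun m => AdjoinRoot.of D.poly (GaloisContinuity.formalLogNum E₀ p m) with hbE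
  set β₂ : ℕ → D.Coeff := fun m => if p ∣ m then (p : D.Coeff) * bE (m / p) else 0 with hβ₂
  have hβW_spec : ∀ m : ℕ, qpToBdR ((m : ℚ_[p])⁻¹) * AinfRam.toBdR D hθ (AinfRam.coeffHom D (βW m)) =
      embBdRHom hp hθ (PowerSeries.coeff m (W.map (EisensteinRoot.CoeffDisc.toF D)).formalLog) :=
    fun m => AinfRam.inv_mul_toBdR_coeffHom_formalInvDiff D hθ W m
  -- (1) the transport and the periods
  obtain ⟨w, ⟨hw, hwv⟩, -⟩ := exists_unique_transport_seqO D W E₀ hWE ψ hψ τ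
  obtain ⟨z, hz⟩ := exists_witness_transport D W E₀ ψ τ hw hwv hN (hθ := hθ)
  have hLTτ := hLT τ w hw hwv z hz
  have hN1 : 1 ≤ N := le_trans D.e_pos hN
  -- work in `BDeRhamPlus`: it suffices that the difference lies in every lattice
  rw [← (BdRPlusTop.of F p).symm.injective.eq_iff]
  rw [← sub_eq_zero]
  refine GaloisContinuity.eq_zero_of_forall_lattice fun k j => ?_
  -- constants for this `k`
  obtain ⟨r, hr⟩ := AinfRam.exists_pow_mul_toBdR_eq D hθ k
  obtain ⟨C, hC⟩ := AinfRam.exists_pow_mul_partialSum_add_sub_partialSum_eq D hθ hr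
  -- the level
  set n : ℕ := j + (C + r + r) with hn
  -- (2) E₀-side descent to level `n`
  obtain ⟨L₁, L₂, hL₁, hL₂, hL₁v, hL₂v⟩ :=
    AinfTop.exists_bmaxPlusToBdR_logSum_eq_pow_mul_value_level E₀ (hθ := hθ) hw hN1 hz n
  set y₁ : Ainf (p := p) F := (AinfTop.of F p).symm
    (((AinfTop.divisionLiftPt E₀ hθ (fun i => w (n + i)) (AinfTop.mulPC_shift E₀ hw n)).val : (AinfTop.nilTheta F p hθ).toIdeal) : AinfTop F p) with hy₁
  -- (3) as ramified values at `algebraMap y₁`, `algebraMap (φ y₁)`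
  have hV₁ := (AinfRam.isLogTypeModFil_iff_value D hθ (GaloisContinuity.formalLogNum E₀ p) k y₁ L₁).1 (hL₁v k)
  have hV₂ := (AinfRam.isLogTypeModFil_iff_value D hθ (GaloisContinuity.formalLogNum E₀ p) k (WittVector.frobenius y₁) L₂).1 (hL₂v k)
  -- (4) W-side: value at the shallow point `y₃ = [τ̃⁽ⁿ⁾]_𝒪`, descent, and the ξ-adic bridge
  set T₃ : AinfRamTop D := AinfRamTop.torsionLift W hθ (fun m => t (n + m)) (fun m => htp (n + m)) with hT₃
  set y₃ : AinfRam D := (AinfRamTop.of D).symm T₃ with hy₃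
  have hT₃mem : T₃ ∈ (AinfRamTop.nilTheta D hθ).toIdeal := AinfRamTop.flim_mem_nilTheta _ _
  obtain ⟨N₃, hN₃pos, hN₃⟩ := AinfRamTop.exists_pos_pow_mem_ideal (D := D) (hθ := hθ) ⟨T₃, hT₃mem⟩
  have hy₃depth : y₃ ^ (N₃ * (1 + (D.e + D.e - 1))) ∈ AinfRam.idealPXi D := by
    have h1 : T₃ ^ ((1 + (D.e + D.e - 1)) * (N₃ * 1)) ∈ (WithIdeal.i : Ideal (AinfRamTop D)) ^ ((1 + (D.e + D.e - 1)) * 1) := by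
      rw [mul_one, mul_comm, pow_mul, mul_one]
      exact Ideal.pow_mem_pow hN₃ _
    have h2 := AinfRamTop.of_symm_mem_idealPXi_pow (D := D) (q := 1) h1
    rw [pow_one, map_pow] at h2
    rw [hy₃, show N₃ * (1 + (D.e + D.e - 1)) = (1 + (D.e + D.e - 1)) * (N₃ * 1) by ring]
    exact h2
  have hN₃1 : 1 ≤ N₃ * (1 + (D.e + D.e - 1)) := Nat.one_le_iff_ne_zero.2 (Nat.mul_ne_zero (by omega) (by omega))
  obtain ⟨V₃, hV₃⟩ := AinfRam.exists_value D hθ hr hN₃1 hy₃depth βW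
  -- descent `pⁿ V₃` is a value at `[t]`, and so is `∫_t ω`
  have hV₃desc := AinfRam.value_torsionLift_of_shift D hθ hr hβW_spec n t htp hV₃
  have hΩ := AinfRam.value_omegaPeriod D hθ (W := W) hβW_spec k ht0 htp
  have hdiff4 := AinfRam.value_sub_value_mem D hθ βW hV₃desc hΩ
  -- (5) the Hodge line at `y₃`: values of the `E₀`-series, the `Xᵖ`-series and the integral remainders
  obtain ⟨Vb, hVb⟩ := AinfRam.exists_value D hθ hr hN₃1 hy₃depth bE
  have hy₃pdepth : (y₃ ^ p) ^ (N₃ * (1 + (D.e + D.e - 1))) ∈ AinfRam.idealPXi D := by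
    rw [← pow_mul, mul_comm, pow_mul]; exact Ideal.pow_mem_of_mem _ hy₃depth _ hpp.out.pos
  obtain ⟨Vb2, hVb2'⟩ := AinfRam.exists_value D hθ hr hN₃1 hy₃pdepth bE
  have hVb2 := AinfRam.value_expand_of_value_pow D hθ bE y₃ hVb2'
  have hVh : ∀ i : Fin D.e, ∃ Vh : BDeRhamPlus (integerC F) p,
      (∀ j' : ℕ, ∃ M₀ : ℕ, ∀ M : ℕ, M₀ ≤ M → ∃ (a' : Ainf (p := p) F) (w' : BDeRhamPlus (integerC F) p),
        Vh - (∑ m ∈ Finset.range M, qpToBdR (((m + 1 : ℕ) : ℚ_[p])⁻¹) *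
          AinfRam.toBdR D hθ (AinfRam.coeffHom D (((m + 1 : ℕ) : D.Coeff) * AdjoinRoot.of D.poly (h i (m + 1))) * y₃ ^ (m + 1))) =
          ainfToBdR ((p : Ainf (p := p) F) ^ j' * a') + xiBdR ^ k * w') ∧
      ∃ (a' : Ainf (p := p) F) (w' : BDeRhamPlus (integerC F) p), (p : BDeRhamPlus (integerC F) p) ^ r * Vh = ainfToBdR a' + xiBdR ^ k * w' := by
    intro i
    obtain ⟨Vh, hVh⟩ := AinfRam.exists_value D hθ hr hN₃1 hy₃depth (fun m => ((m : ℕ) : D.Coeff) * AdjoinRoot.of D.poly (h i m))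
    exact ⟨Vh, hVh, AinfRam.exists_pow_mul_value_eq_of_natCast_mul D hθ hr (fun m => AdjoinRoot.of D.poly (h i m)) y₃ hVh⟩
  choose Vh hVhv hVhb using hVh
  -- the combination `Σᵢ ϖⁱ(aᵢ Vb + bbᵢ Vb2 + Vhᵢ)` is a value of the RHS numerators of `hHL`, `p^c V₃` of the LHS numerators
  set βR : Fin D.e → ℕ → D.Coeff := fun i m => AdjoinRoot.root D.poly ^ (i : ℕ) *
    (AdjoinRoot.of D.poly (a i) * bE m + AdjoinRoot.of D.poly (bb i) * β₂ m + (m : D.Coeff) * AdjoinRoot.of D.poly (h i m)) with hβR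
  set eI : Fin D.e → BDeRhamPlus (integerC F) p := fun i => AinfRam.toBdR D hθ (AinfRam.coeffHom D (AdjoinRoot.root D.poly ^ (i : ℕ))) with heI
  set αI : Fin D.e → BDeRhamPlus (integerC F) p := fun i => AinfRam.toBdR D hθ (AinfRam.coeffHom D (AdjoinRoot.of D.poly (a i))) with hαI
  set γI : Fin D.e → BDeRhamPlus (integerC F) p := fun i => AinfRam.toBdR D hθ (AinfRam.coeffHom D (AdjoinRoot.of D.poly (bb i))) with hγI
  have hcombo : ∀ i ∈ (Finset.univ : Finset (Fin D.e)), ∀ j' : ℕ, ∃ M₀ : ℕ, ∀ M : ℕ, M₀ ≤ M → ∃ (a' : Ainf (p := p) F) (w' : BDeRhamPlus (integerC F) p),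
      (fun i => eI i * (αI i * Vb + γI i * Vb2 + Vh i)) i -
        (∑ m ∈ Finset.range M, qpToBdR (((m + 1 : ℕ) : ℚ_[p])⁻¹) * AinfRam.toBdR D hθ (AinfRam.coeffHom D (βR i (m + 1)) * y₃ ^ (m + 1))) =
        ainfToBdR ((p : Ainf (p := p) F) ^ j' * a') + xiBdR ^ k * w' := by
    intro i _
    have h1 := AinfRam.value_mul_left D hθ hr (AdjoinRoot.of D.poly (a i)) bE y₃ hVb
    have h2 := AinfRam.value_mul_left D hθ hr (AdjoinRoot.of D.poly (bb i)) β₂ y₃ hVb2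
    have h12 := AinfRam.value_add D hθ (fun m => AdjoinRoot.of D.poly (a i) * bE m) (fun m => AdjoinRoot.of D.poly (bb i) * β₂ m) y₃ h1 h2
    have h123 := AinfRam.value_add D hθ (fun m => AdjoinRoot.of D.poly (a i) * bE m + AdjoinRoot.of D.poly (bb i) * β₂ m)
      (fun m => (m : D.Coeff) * AdjoinRoot.of D.poly (h i m)) y₃ h12 (hVhv i)
    exact AinfRam.value_mul_left D hθ hr (AdjoinRoot.root D.poly ^ (i : ℕ))
      (fun m => AdjoinRoot.of D.poly (a i) * bE m + AdjoinRoot.of D.poly (bb i) * β₂ m + (m : D.Coeff) * AdjoinRoot.of D.poly (h i m)) y₃ h123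
  have hRHS := AinfRam.value_sum D hθ (Finset.univ : Finset (Fin D.e)) βR y₃ (L := fun i => eI i * (αI i * Vb + γI i * Vb2 + Vh i)) hcombo
  have hLHS := AinfRam.value_mul_left D hθ hr ((p : D.Coeff) ^ c) βW y₃ hV₃
  -- the numerators agree (`hHL`)
  have hnum : ∀ m : ℕ, (p : D.Coeff) ^ c * βW m = ∑ i ∈ (Finset.univ : Finset (Fin D.e)), βR i m := fun m => hHL m
  have hLHS' : ∀ j' : ℕ, ∃ M₀ : ℕ, ∀ M : ℕ, M₀ ≤ M → ∃ (a' : Ainf (p := p) F) (w' : BDeRhamPlus (integerC F) p),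
      AinfRam.toBdR D hθ (AinfRam.coeffHom D ((p : D.Coeff) ^ c)) * V₃ -
        (∑ m ∈ Finset.range M, qpToBdR (((m + 1 : ℕ) : ℚ_[p])⁻¹) * AinfRam.toBdR D hθ (AinfRam.coeffHom D
          (∑ i ∈ (Finset.univ : Finset (Fin D.e)), βR i (m + 1)) * y₃ ^ (m + 1))) =
        ainfToBdR ((p : Ainf (p := p) F) ^ j' * a') + xiBdR ^ k * w' := by
    intro j'
    obtain ⟨M₀, hM₀⟩ := hLHS j'
    refine ⟨M₀, fun M hM => ?_⟩
    obtain ⟨a', w', h'⟩ := hM₀ M hM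
    refine ⟨a', w', ?_⟩
    simp only [hnum] at h'
    exact h'
  have hdiff5 := AinfRam.value_sub_value_mem D hθ (fun m => ∑ i ∈ (Finset.univ : Finset (Fin D.e)), βR i m) hLHS' hRHS
  -- (6) continuity: `y₃` vs `algebraMap y₁`, `y₃ᵖ` vs `algebraMap (φ y₁)`
  have hθT₃ : AinfRamTop.theta D T₃ = t n := by
    rw [hT₃, AinfRamTop.theta_torsionLift_eq, Nat.add_zero]
  have hθy₁ : ((AinfTop.theta F p (AinfTop.of F p y₁) : CBall F) : CompletedAlgClosure F) =
      (((w n : (maxNilIdealC F).toIdeal) : CBall F) : CompletedAlgClosure F) := by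
    have h1 := AinfTop.thetaPt_divisionLiftPt E₀ (hθ := hθ) (fun i => w (n + i)) (AinfTop.mulPC_shift E₀ hw n)
    have h2 := congrArg (fun P : (E₀).Pt (maxNilIdealC F) => ((P.val : CBall F) : CompletedAlgClosure F)) h1
    simp only [AinfTop.coe_val_thetaPt] at h2
    rw [hy₁, RingEquiv.apply_symm_apply]
    simpa using h2
  have hclose1 : y₃ - algebraMap (Ainf (p := p) F) (AinfRam D) y₁ ∈ Ideal.span {AinfRam.varpi D, AinfRam.omega D} := by
    have h := AinfRamTop.sub_mem_span_varpi_omega_of_norm_theta_sub_le (D := D) hθ (a := T₃) (b := AinfRamTop.of D (algebraMap (Ainf (p := p) F) (AinfRam D) y₁)) (by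
      rw [hθT₃, AinfRamTop.coe_theta, AinfRam.theta_algebraMap, ← AinfTop.coe_theta, hθy₁, norm_sub_rev]
      exact hwv n)
    rwa [RingEquiv.symm_apply_apply] at h
  have hclose2 : y₃ ^ p - algebraMap (Ainf (p := p) F) (AinfRam D) (WittVector.frobenius y₁) ∈ Ideal.span {AinfRam.varpi D, AinfRam.omega D} := by
    have hρ1 : ‖((D.rootC : integerC F) : CompletedAlgClosure F)‖ ≤ 1 := D.norm_rootC_lt_one.le
    have hpϖ : ‖(p : CompletedAlgClosure F)‖ ≤ ‖((D.rootC : integerC F) : CompletedAlgClosure F)‖ := by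
      rw [← D.norm_rootC_pow]
      exact pow_le_of_le_one (norm_nonneg _) hρ1 (ne_of_gt D.e_pos)
    have h := AinfRamTop.sub_mem_span_varpi_omega_of_norm_theta_sub_le (D := D) hθ (a := T₃ ^ p)
      (b := AinfRamTop.of D (algebraMap (Ainf (p := p) F) (AinfRam D) (WittVector.frobenius y₁))) (by
      rw [map_pow, Subring.coe_pow, hθT₃, AinfRamTop.coe_theta, AinfRam.theta_algebraMap]
      have hφ := AinfTop.norm_theta_frob_sub_pow_le (F := F) (p := p) (AinfTop.of F p y₁)
      rw [RingEquiv.symm_apply_apply, AinfTop.coe_theta, hθy₁] at hφ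
      have hpw : ‖(((t n : (maxNilIdealC F).toIdeal) : CBall F) : CompletedAlgClosure F) ^ p -
          (((w n : (maxNilIdealC F).toIdeal) : CBall F) : CompletedAlgClosure F) ^ p‖ ≤ ‖((D.rootC : integerC F) : CompletedAlgClosure F)‖ :=
        (AinfRamTop.norm_pow_sub_pow_le_of_le (t n).1.2 (w n).1.2 p).trans (by rw [norm_sub_rev]; exact hwv n)
      have e : (((t n : (maxNilIdealC F).toIdeal) : CBall F) : CompletedAlgClosure F) ^ p -
          ((fontaineTheta (integerC F) p (WittVector.frobenius y₁) : integerC F) : CompletedAlgClosure F) =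
          ((((t n : (maxNilIdealC F).toIdeal) : CBall F) : CompletedAlgClosure F) ^ p -
            (((w n : (maxNilIdealC F).toIdeal) : CBall F) : CompletedAlgClosure F) ^ p) -
          (((fontaineTheta (integerC F) p (WittVector.frobenius y₁) : integerC F) : CompletedAlgClosure F) -
            (((w n : (maxNilIdealC F).toIdeal) : CBall F) : CompletedAlgClosure F) ^ p) := by ring
      rw [e]
      have hum : ∀ x y : CompletedAlgClosure F, ‖x - y‖ ≤ max ‖x‖ ‖y‖ := fun x y => by
        simpa only [sub_eq_add_neg, norm_neg] using IsUltrametricDist.norm_add_le_max x (-y)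
      exact (hum _ _).trans (max_le hpw (hφ.trans hpϖ)))
    rwa [map_pow, RingEquiv.symm_apply_apply] at h
  obtain ⟨a1, w1, h1⟩ : ∃ (a' : Ainf (p := p) F) (w' : BDeRhamPlus (integerC F) p),
      (p : BDeRhamPlus (integerC F) p) ^ C * (Vb - L₁) = ainfToBdR a' + xiBdR ^ k * w' :=
    AinfRam.pow_mul_value_sub_value_mem D hθ hC bE (y := algebraMap (Ainf (p := p) F) (AinfRam D) y₁)
      (δ := y₃ - algebraMap (Ainf (p := p) F) (AinfRam D) y₁) hclose1 hV₁ (L' := Vb) (by rw [add_sub_cancel]; exact hVb)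
  obtain ⟨a2, w2, h2⟩ : ∃ (a' : Ainf (p := p) F) (w' : BDeRhamPlus (integerC F) p),
      (p : BDeRhamPlus (integerC F) p) ^ C * (Vb2 - L₂) = ainfToBdR a' + xiBdR ^ k * w' :=
    AinfRam.pow_mul_value_sub_value_mem D hθ hC bE (y := algebraMap (Ainf (p := p) F) (AinfRam D) (WittVector.frobenius y₁))
      (δ := y₃ ^ p - algebraMap (Ainf (p := p) F) (AinfRam D) (WittVector.frobenius y₁)) hclose2 hV₂ (L' := Vb2) (by rw [add_sub_cancel]; exact hVb2')
  -- (7) assemble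
  obtain ⟨c4, hc4⟩ := Ideal.mem_span_singleton'.1 hdiff4
  obtain ⟨c5, hc5⟩ := Ideal.mem_span_singleton'.1 hdiff5
  set Ω : BDeRhamPlus (integerC F) p := (BdRPlusTop.of F p).symm (AinfRamTop.omegaPeriod W hθ t ht0 htp) with hΩdef
  set S : BDeRhamPlus (integerC F) p := ∑ i ∈ (Finset.univ : Finset (Fin D.e)), (fun i => eI i * (αI i * Vb + γI i * Vb2 + Vh i)) i with hSdef
  have hΩ'' : Ω = (p : BDeRhamPlus (integerC F) p) ^ n * V₃ - c4 * xiBdR ^ k := by rw [hc4]; ring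
  have hpc : AinfRam.toBdR D hθ (AinfRam.coeffHom D ((p : D.Coeff) ^ c)) = (p : BDeRhamPlus (integerC F) p) ^ c := by
    rw [map_pow, map_natCast, map_pow, map_natCast]
  have hV₃'' : (p : BDeRhamPlus (integerC F) p) ^ c * V₃ = S + c5 * xiBdR ^ k := by
    rw [← hpc, hc5]; ring
  -- the per-`i` error terms are small
  have hTi : ∀ i ∈ (Finset.univ : Finset (Fin D.e)), ∃ (a' : Ainf (p := p) F) (w' : BDeRhamPlus (integerC F) p),
      eI i * ((p : BDeRhamPlus (integerC F) p) ^ (C + r + r) * (αI i * (L₁ - Vb) + γI i * (L₂ - Vb2) - Vh i)) =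
        ainfToBdR ((p : Ainf (p := p) F) ^ 0 * a') + xiBdR ^ k * w' := by
    intro i _
    obtain ⟨ae, we, he⟩ := hr (AinfRam.coeffHom D (AdjoinRoot.root D.poly ^ (i : ℕ)))
    obtain ⟨a3, w3, h3⟩ := hVhb i
    -- `p^{C+r+r}·(…) ∈ Λ(r, k)`
    have hin : (p : BDeRhamPlus (integerC F) p) ^ (C + r + r) * (αI i * (L₁ - Vb) + γI i * (L₂ - Vb2) - Vh i) =
        ainfToBdR ((p : Ainf (p := p) F) ^ (0 + r) *
          (-((p : Ainf (p := p) F) ^ r * (zpToAinf (a i) * a1 + zpToAinf (bb i) * a2)) - (p : Ainf (p := p) F) ^ C * a3)) +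
        xiBdR ^ k * ((p : BDeRhamPlus (integerC F) p) ^ r *
          (-((p : BDeRhamPlus (integerC F) p) ^ r * (αI i * w1 + γI i * w2)) - (p : BDeRhamPlus (integerC F) p) ^ C * w3)) := by
      have eα : αI i = ainfToBdR (zpToAinf (a i)) := by rw [hαI]; exact (toBdR_coeffHom_of D (a i)).trans (qpToBdR_coe (a i))
      have eγ : γI i = ainfToBdR (zpToAinf (bb i)) := by rw [hγI]; exact (toBdR_coeffHom_of D (bb i)).trans (qpToBdR_coe (bb i))
      have e1 : (p : BDeRhamPlus (integerC F) p) ^ (C + r + r) * (αI i * (L₁ - Vb) + γI i * (L₂ - Vb2) - Vh i) =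
          (p : BDeRhamPlus (integerC F) p) ^ r * (-((p : BDeRhamPlus (integerC F) p) ^ r *
            (αI i * ((p : BDeRhamPlus (integerC F) p) ^ C * (Vb - L₁)) + γI i * ((p : BDeRhamPlus (integerC F) p) ^ C * (Vb2 - L₂)))) -
            (p : BDeRhamPlus (integerC F) p) ^ C * ((p : BDeRhamPlus (integerC F) p) ^ r * Vh i)) := by ring
      rw [e1, h1, h2, h3, eα, eγ, zero_add]
      simp only [map_add, map_sub, map_neg, map_mul, map_pow, map_natCast]
      ring
    exact lattice_mul_of_bounded he hin
  obtain ⟨A, Wt, hsumT⟩ := lattice_sum (Finset.univ : Finset (Fin D.e)) hTi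
  rw [pow_zero, one_mul] at hsumT
  -- the periods
  have hP : (BdRPlusTop.of F p).symm (P₀ τ) = (p : BDeRhamPlus (integerC F) p) ^ (N + n) * L₁ := by
    rw [hP₀, RingEquiv.symm_apply_apply, hLTτ, hL₁]
  have hQ : (BdRPlusTop.of F p).symm (Q₀ τ) = (p : BDeRhamPlus (integerC F) p) ^ (N + n) * L₂ := by
    rw [hQ₀, RingEquiv.symm_apply_apply, hLTτ, hL₂]
  have heI' : ∀ i : Fin D.e, embBdRHom hp hθ (D.root ^ (i : ℕ)) = eI i := fun i => (toBdR_coeffHom_root_pow D (i : ℕ)).symm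
  have hαI' : ∀ i : Fin D.e, qpToBdR (a i : ℚ_[p]) = αI i := fun i => (toBdR_coeffHom_of D (a i)).symm
  have hγI' : ∀ i : Fin D.e, qpToBdR (bb i : ℚ_[p]) = γI i := fun i => (toBdR_coeffHom_of D (bb i)).symm
  -- sums as scalar multiples
  have hS1 : ∑ i : Fin D.e, eI i * (αI i * ((p : BDeRhamPlus (integerC F) p) ^ (N + n) * L₁) + γI i * ((p : BDeRhamPlus (integerC F) p) ^ (N + n) * L₂)) =
      (p : BDeRhamPlus (integerC F) p) ^ (N + n) * ∑ i : Fin D.e, eI i * (αI i * L₁ + γI i * L₂) := by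
    rw [Finset.mul_sum]; exact Finset.sum_congr rfl fun i _ => by ring
  have hS2 : ∑ i : Fin D.e, eI i * (αI i * L₁ + γI i * L₂) - S =
      ∑ i : Fin D.e, eI i * (αI i * (L₁ - Vb) + γI i * (L₂ - Vb2) - Vh i) := by
    rw [hSdef, ← Finset.sum_sub_distrib]; exact Finset.sum_congr rfl fun i _ => by ring
  have hS3 : ∑ i : Fin D.e, eI i * ((p : BDeRhamPlus (integerC F) p) ^ (C + r + r) * (αI i * (L₁ - Vb) + γI i * (L₂ - Vb2) - Vh i)) =
      (p : BDeRhamPlus (integerC F) p) ^ (C + r + r) * ∑ i : Fin D.e, eI i * (αI i * (L₁ - Vb) + γI i * (L₂ - Vb2) - Vh i) := by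
    rw [Finset.mul_sum]; exact Finset.sum_congr rfl fun i _ => by ring
  have hpow : (p : BDeRhamPlus (integerC F) p) ^ (N + n) = (p : BDeRhamPlus (integerC F) p) ^ (N + j) * (p : BDeRhamPlus (integerC F) p) ^ (C + r + r) := by
    rw [← pow_add, hn, ← add_assoc]
  refine ⟨(p : Ainf (p := p) F) ^ N * A, (p : BDeRhamPlus (integerC F) p) ^ (N + j) * Wt +
    ((p : BDeRhamPlus (integerC F) p) ^ (N + c) * c4 - (p : BDeRhamPlus (integerC F) p) ^ (N + n) * c5), ?_⟩
  -- rewrite the goal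
  simp only [map_sum, map_mul, map_add, RingEquiv.symm_apply_apply, heI', hαI', hγI', hP, hQ]
  simp only [map_pow, map_natCast]
  rw [← hΩdef]
  linear_combination hS1 - ((p : BDeRhamPlus (integerC F) p) ^ (N + c)) * hΩ'' -
    ((p : BDeRhamPlus (integerC F) p) ^ N * (p : BDeRhamPlus (integerC F) p) ^ n) * hV₃'' +
    ((p : BDeRhamPlus (integerC F) p) ^ (N + n)) * hS2 - ((p : BDeRhamPlus (integerC F) p) ^ (N + j)) * hS3 +
    ((p : BDeRhamPlus (integerC F) p) ^ (N + j)) * hsumT +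
    (∑ i : Fin D.e, eI i * (αI i * (L₁ - Vb) + γI i * (L₂ - Vb2) - Vh i)) * hpow

include hWE hψ in
/-- ★ **`hne` for the Hodge pair, unconditionally.** If the direct ω-period `∫_τ ω_{W_D}` is nonzero (tree (N1′):
`AinfRamTop.omegaPeriod_model_five_ne_zero`, `…_seven_ne_zero`, `omegaPeriod_ne_zero_of_varpi_shape` for `τ₁ ≠ 0`), then the transported Hodge
combination `Σᵢ ι_F(ϖ)ⁱ·(aᵢ·P⁰τ + bᵢ·Q⁰τ)` is nonzero in `B_dR⁺` — the capstone's hypothesis `hne`, with no appeal to Fontaine's injectivity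
`F ⊗ B_max⁺ → B_dR⁺`. [cite: Fontaine1982FormesDifferentielles, §5] [cite: Colmez1992PeriodesAbeliennes, §2] -/
theorem transported_hodgeCombination_ne_zero
    [(E₀.map (Int.castRingHom ℚ_[p])).IsElliptic] [(E₀.map (Int.castRingHom (ZMod p))).IsElliptic]
    {N : ℕ} (hN : D.e ≤ N) {LT : AinfTop.TatePtO F (W.map ψ) p →+ BmaxPlus F p} {P₀ Q₀ : AinfTop.TatePtO F (W.map ψ) p →+ BdRPlusTop F p}
    (hLT : ∀ (τ : AinfTop.TatePtO F (W.map ψ) p) (w : ℕ → (maxNilIdealC F).toIdeal) (hw : ∀ n, AinfTop.mulPC F p E₀ (w (n + 1)) = w n)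
        (_ : ∀ n, ‖(((w n : (maxNilIdealC F).toIdeal) : CBall F) : CompletedAlgClosure F) -
      (((AinfTop.seqO (W.map ψ) τ n : (maxNilIdealC F).toIdeal) : CBall F) : CompletedAlgClosure F)‖ ≤ ‖((D.rootC : integerC F) : CompletedAlgClosure F)‖)
        (z : bmaxZero F p), algebraMap (Ainf (p := p) F) (bmaxZero F p)
        ((AinfTop.of F p).symm (((AinfTop.divisionLiftPt E₀ hθ w hw).val : (AinfTop.nilTheta F p hθ).toIdeal) : AinfTop F p)) ^ N =
      (p : bmaxZero F p) * z →
        LT τ = PadicLogSeries.logSum ((algebraMap (Ainf (p := p) F) (bmaxZero F p)).comp zpToAinf) (GaloisContinuity.formalLogNum E₀ p) N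
          (algebraMap (Ainf (p := p) F) (bmaxZero F p)
            ((AinfTop.of F p).symm (((AinfTop.divisionLiftPt E₀ hθ w hw).val : (AinfTop.nilTheta F p hθ).toIdeal) : AinfTop F p))) z)
    (hP₀ : ∀ τ, P₀ τ = BdRPlusTop.of F p (bmaxPlusToBdR F p (LT τ)))
    (hQ₀ : ∀ τ, Q₀ τ = BdRPlusTop.of F p (bmaxPlusToBdR F p (frobBmaxPlus F p (LT τ))))
    (c : ℕ) (a bb : Fin D.e → ℤ_[p]) (h : Fin D.e → ℕ → ℤ_[p])
    (hHL : ∀ m : ℕ, (p : D.Coeff) ^ c * (EisensteinRoot.CoeffDisc.of D).symm (PowerSeries.coeff (m - 1) W.formalInvDiff) =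
      ∑ i : Fin D.e, AdjoinRoot.root D.poly ^ (i : ℕ) *
        (AdjoinRoot.of D.poly (a i) * AdjoinRoot.of D.poly (GaloisContinuity.formalLogNum E₀ p m) +
          AdjoinRoot.of D.poly (bb i) * (if p ∣ m then (p : D.Coeff) * AdjoinRoot.of D.poly (GaloisContinuity.formalLogNum E₀ p (m / p)) else 0) +
          (m : D.Coeff) * AdjoinRoot.of D.poly (h i m)))
    (τ : AinfTop.TatePtO F (W.map ψ) p)
    (hΩ : AinfRamTop.omegaPeriod W hθ (AinfTop.seqO (W.map ψ) τ) (AinfTop.seqO_zero (W.map ψ) τ) (AinfRamTop.mulPC_seqO W ψ hψ τ) ≠ 0) :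
    ∑ i : Fin D.e, BdRPlusTop.of F p (embBdRHom hp hθ (D.root ^ (i : ℕ))) *
        (BdRPlusTop.of F p (qpToBdR (a i : ℚ_[p])) * P₀ τ + BdRPlusTop.of F p (qpToBdR (bb i : ℚ_[p])) * Q₀ τ) ≠ 0 := by
  rw [transported_hodgeCombination_eq_pow_mul_omegaPeriod D W E₀ hWE ψ hψ hN hLT hP₀ hQ₀ c a bb h hHL τ]
  have hu : IsUnit ((p : BdRPlusTop F p) ^ (N + c)) := by
    have h1 : IsUnit (p : ℚ_[p]) := isUnit_iff_ne_zero.2 (Nat.cast_ne_zero.2 hpp.out.ne_zero)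
    have h2 := (h1.map (qpToBdR (F := F) (p := p))).map (BdRPlusTop.of F p)
    rw [map_natCast, map_natCast] at h2
    exact h2.pow _
  exact fun h0 => hΩ (hu.mul_right_eq_zero.1 h0)

end Summit.BirchSwinnertonDyer.BirchSwinnertonDyer.Theorems.TransportedHodgeLineBdR

end
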